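import Summits.AtomisticToContinuum.FouriersLaw.Theses.CageBudgetFekete
import Summits.AtomisticToContinuum.FouriersLaw.Theorems.HeatVarianceCeiling.Negative.LoadBearing
import Summits.AtomisticToContinuum.FouriersLaw.Theorems.HeatVarianceCeiling.Negative.Rigidity
import Summits.AtomisticToContinuum.FouriersLaw.Theorems.HeatVarianceCalculus.Negative.LoadBearing
import Literature.MathematicalPhysics.KineticTheory.InfiniteChainCurrentPositiveType
import Literature.MathematicalPhysics.KineticTheory.InfiniteChainShiftInvariantUniqueness

/-!
# `CageBudgetFekete.HeatVarianceCeiling` / Negative (3): the ballistic envelope and the `τ₁`-free form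

Support file (`--supports stmt-AtomisticToContinuum-15770`) of the crux disprover of
`Summit.AtomisticToContinuum.FouriersLaw.Theses.CageBudgetFekete.HeatVarianceCeiling`.

In the CORE arena of the crux (`pinnedChain ω₂ lam β γ`, `ω₂, lam, β > 0`; `T > 0`; `μ` a
shift-invariant DLR state; `D` ANY dynamics preserving `μ` — no covariance, reversal, convergence or
continuity hypothesis, all idle by `Negative/Rigidity.lean`):

* `abs_currentCorrelation_le` — `|C_T(t)| ≤ C_T(0)` for every `t` (positive type of the canonical
  Buttà–Marchioro memory, transferred to `D` by rigidity);
* `heatVariance_le_ballistic` — the BALLISTIC ENVELOPE `V_T(τ) ≤ C_T(0) τ²` for `τ ≥ 0`. Its SHAPE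
  `cτ²` is attained by the frozen junk flow of `Negative/LoadBearing.lean` and, up to the Drude factor, by
  the harmonic member; numerically the true `V_T` follows it within 25–40 % through the kinetic window
  (kit j024425 of the strategist). The crux is exactly the improvement of the exponent `2 → 1` BEYOND
  the kinetic time — nothing at finite times can decide it;
* `ceiling_iff_ceiling_from_zero` — because of the envelope, the conclusion `∃ B τ₁, ∀ τ ≥ τ₁, V ≤ Bτ`
  is equivalent to the `τ₁`-free `∃ B, ∀ τ ≥ 0, V ≤ Bτ` (take `B ⊔ C(0)τ₁`): the threshold `τ₁` of the
  crux carries no content (it only absorbs `τ < 0`, where `V = 0`).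

No new definitions. refuter-cdisprove-stmt-AtomisticToContinuum-15770-0, 2026-08-17.
-/

noncomputable section

namespace Summit.AtomisticToContinuum.FouriersLaw.Theorems.HeatVarianceCeiling.Negative

open MeasureTheory Filter Set Topology
open Literature.MathematicalPhysics.KineticTheory.HeatConduction
open Summit.AtomisticToContinuum.FouriersLaw.Theorems

/-- **Measurability and `|C_T(t)| ≤ C_T(0)`, core arena.** For `pinnedChain ω₂ lam β γ`
(`ω₂, lam, β > 0`), `T > 0`, a shift-invariant DLR state `μ` and ANY dynamics `D` preserving `μ` with
absolutely convergent correlation sums: `C = D.currentCorrelation μ` is measurable and bounded by its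
value at `0`. (The canonical dynamics on `bmGood` preserves `μ`, has the same correlation terms as `D`
(rigidity), is a.e. shift covariant, and its memory is of positive type.) [folklore] -/
theorem measurable_and_abs_currentCorrelation_le {ω₂ lam β : ℝ} (γ : ℝ) (hω : 0 < ω₂) (hl : 0 < lam)
    (hβ : 0 < β) {T : ℝ} (hT : 0 < T) {μ : Measure ChainConfig}
    (hG : (pinnedChain ω₂ lam β γ).IsChainGibbsMeasure T μ) (hSI : IsShiftInvariant μ)
    (D : InfiniteChainDynamics (pinnedChain ω₂ lam β γ)) (hP : D.PreservesMeasure μ)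
    (hAC : ∀ t : ℝ, D.HasAbsConvergentCorrelation μ t) :
    Measurable (D.currentCorrelation μ) ∧
      ∀ t : ℝ, |D.currentCorrelation μ t| ≤ D.currentCorrelation μ 0 := by
  have hss : (pinnedChain ω₂ lam β γ).HasSuperstabilityEstimate μ :=
    OscillatorChain.hasSuperstabilityEstimate_of_isShiftInvariant_pinnedChain γ hω hl.le hβ.le hT hG hSI
  obtain ⟨D', hcar, -, -, -, hpres⟩ :=
    GreenKuboContinuation.TemperatureBlindVitaliHurwitz.exists_bmDynamics_pinnedChain γ hω.le hl hβ
  have hP' : D'.PreservesMeasure μ := hpres T μ hG hss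
  have hAC' : ∀ t : ℝ, D'.HasAbsConvergentCorrelation μ t := fun t =>
    (hasAbsConvergentCorrelation_iff_of_preservesMeasure γ hω hl hβ hT hG hSI D D' hP hP' t).1 (hAC t)
  obtain ⟨hm, hb, -⟩ := D'.currentCorrelation_positiveType_of_carrier_subset_bmGood (μ := μ)
    (s₁ := 2) (s₂ := 2) (by norm_num) (by norm_num)
    (OscillatorChain.pinnedChain_isEvenPolyOfDegree_U β γ hω.le hl)
    (OscillatorChain.pinnedChain_isEvenPolyOfDegree_V ω₂ lam γ hβ) hss hSI hcar.subset hP' hAC'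
  have heq : D.currentCorrelation μ = D'.currentCorrelation μ :=
    funext fun t => currentCorrelation_eq_of_preservesMeasure γ hω hl hβ hT hG hSI D D' hP hP' t
  rw [heq]
  exact ⟨hm, hb⟩

/-- **The ballistic envelope.** Core arena, `τ ≥ 0`: `V_T(τ) = 2∫_{(0,τ]}(τ-s)C_T(s)ds ≤ C_T(0)·τ²`.
[folklore] -/
theorem heatVariance_le_ballistic {ω₂ lam β : ℝ} (γ : ℝ) (hω : 0 < ω₂) (hl : 0 < lam)
    (hβ : 0 < β) {T : ℝ} (hT : 0 < T) {μ : Measure ChainConfig}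
    (hG : (pinnedChain ω₂ lam β γ).IsChainGibbsMeasure T μ) (hSI : IsShiftInvariant μ)
    (D : InfiniteChainDynamics (pinnedChain ω₂ lam β γ)) (hP : D.PreservesMeasure μ)
    (hAC : ∀ t : ℝ, D.HasAbsConvergentCorrelation μ t) {τ : ℝ} (hτ : 0 ≤ τ) :
    2 * ∫ s in Set.Ioc (0:ℝ) τ, (τ - s) * D.currentCorrelation μ s ≤
      D.currentCorrelation μ 0 * τ ^ 2 := by
  obtain ⟨hm, hb⟩ := measurable_and_abs_currentCorrelation_le γ hω hl hβ hT hG hSI D hP hAC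
  set C := D.currentCorrelation μ with hC
  rw [← heatVariance_const (C 0) τ hτ]
  have hbound : ∀ s ∈ Ioc (0:ℝ) τ, (τ - s) * C s ≤ (τ - s) * C 0 := fun s hs =>
    mul_le_mul_of_nonneg_left ((le_abs_self _).trans (hb s)) (sub_nonneg.2 hs.2)
  have hint : IntegrableOn (fun s => (τ - s) * C s) (Ioc (0:ℝ) τ) := by
    refine Integrable.mono' (g := fun _ => τ * C 0) (integrable_const _)
      (((continuous_const.sub continuous_id).measurable.mul hm).aestronglyMeasurable)
      ((ae_restrict_iff' measurableSet_Ioc).2 (Eventually.of_forall fun s hs => ?_))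
    rw [Real.norm_eq_abs, abs_mul, abs_of_nonneg (sub_nonneg.2 hs.2)]
    exact mul_le_mul (by linarith [hs.1]) (hb s) (abs_nonneg _) hτ
  have hint0 : IntegrableOn (fun s => (τ - s) * C 0) (Ioc (0:ℝ) τ) :=
    Continuous.integrableOn_Ioc (by fun_prop)
  have key : ∫ s in Ioc (0:ℝ) τ, (τ - s) * C s ≤ ∫ s in Ioc (0:ℝ) τ, (τ - s) * C 0 :=
    setIntegral_mono_on hint hint0 measurableSet_Ioc hbound
  linarith

/-- **The threshold `τ₁` is idle.** Core arena: `(∃ B τ₁, ∀ τ ≥ τ₁, V_T(τ) ≤ Bτ) ↔ (∃ B, ∀ τ ≥ 0, V_T(τ) ≤ Bτ)`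
— on `[0, τ₁]` the envelope gives `V_T(τ) ≤ C_T(0)τ₁·τ`. [folklore] -/
theorem ceiling_iff_ceiling_from_zero {ω₂ lam β : ℝ} (γ : ℝ) (hω : 0 < ω₂) (hl : 0 < lam)
    (hβ : 0 < β) {T : ℝ} (hT : 0 < T) {μ : Measure ChainConfig}
    (hG : (pinnedChain ω₂ lam β γ).IsChainGibbsMeasure T μ) (hSI : IsShiftInvariant μ)
    (D : InfiniteChainDynamics (pinnedChain ω₂ lam β γ)) (hP : D.PreservesMeasure μ)
    (hAC : ∀ t : ℝ, D.HasAbsConvergentCorrelation μ t) :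
    (∃ B τ₁ : ℝ, ∀ τ : ℝ, τ₁ ≤ τ →
        2 * ∫ s in Set.Ioc (0:ℝ) τ, (τ - s) * D.currentCorrelation μ s ≤ B * τ) ↔
      ∃ B : ℝ, ∀ τ : ℝ, 0 ≤ τ →
        2 * ∫ s in Set.Ioc (0:ℝ) τ, (τ - s) * D.currentCorrelation μ s ≤ B * τ := by
  constructor
  · rintro ⟨B, τ₁, hB⟩
    have hC0 : 0 ≤ D.currentCorrelation μ 0 := by
      have := (measurable_and_abs_currentCorrelation_le γ hω hl hβ hT hG hSI D hP hAC).2 0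
      exact (abs_nonneg _).trans this
    refine ⟨max B (D.currentCorrelation μ 0 * max τ₁ 0), fun τ hτ => ?_⟩
    rcases le_or_gt τ₁ τ with h | h
    · exact (hB τ h).trans (mul_le_mul_of_nonneg_right (le_max_left _ _) hτ)
    · have h1 := heatVariance_le_ballistic γ hω hl hβ hT hG hSI D hP hAC hτ
      have h2 : D.currentCorrelation μ 0 * τ ^ 2 ≤ D.currentCorrelation μ 0 * max τ₁ 0 * τ := by
        rw [sq, ← mul_assoc]
        exact mul_le_mul_of_nonneg_right
          (mul_le_mul_of_nonneg_left (h.le.trans (le_max_left _ _)) hC0) hτ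
      exact h1.trans (h2.trans (mul_le_mul_of_nonneg_right (le_max_right _ _) hτ))
  · rintro ⟨B, hB⟩
    exact ⟨B, 0, hB⟩

end Summit.AtomisticToContinuum.FouriersLaw.Theorems.HeatVarianceCeiling.Negative

end
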